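import Mathlib
import Literature.MathematicalPhysics.QuantumFieldTheory.Balaban1983to89.B1Sect3Statements
import Literature.MathematicalPhysics.QuantumFieldTheory.Balaban1983to89.B10Eq24Cumulant
import Literature.MathematicalPhysics.QuantumFieldTheory.Balaban1983to89.B1LowerBound

/-!
# `Balaban1983to89.B1Eq324CumulantTaylor` — [Balaban1982Higgs1] (3.23)–(3.24) p. 616 KNITTED: the row-of-record
# carriers `B1Sect3Statements.trunc2 / trunc3 / Eq324` identified with the kernel-checked cumulant calculus of
# `B10Eq24Cumulant` (`truncExp`, `cgf_taylor_lagrange`, `chiMeasure`), and the display (3.24) — verbatim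
# `⟨χ exp V⟩ = exp[Σ_{n≤n̄} (1/n!)⟨Vⁿ⟩ᵀ + O(ε^κ)|T₁|]` — DISCHARGED from three named smallness inputs

statement-level skeleton of published theorems with citation tags; proofs where landed; nothing here is a
claim about the Yang–Mills mass gap

CITATION HEADER (lean-in-tree rule).  Source: T. Bałaban, *(Higgs)₂,₃ quantum fields in a finite volume. I. A lower
bound*, Commun. Math. Phys. **85** (1982) 603–636 [Balaban1982Higgs1] (cell paper B1; PDF
`paper:balaban1982-cmp85-higgs23-i`, journal page = PDF page + 602; p. 616 = PDF 14 read on the x2 render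
`run/shared/lean/pub/pub-balaban/b2b-balaban-ref1/pages/1982-cmp85-higgs23-I/…p014`).  Mega-formalization `lit-balaban`
(HOME `run/shared/lean/pub/lit-balaban/`), Phase-2 proof seat p27, generation 2 (unit `lit-balaban-p27`); rows of block
B1 (owners r01/r12/r14; statement file of record `B1Sect3Statements`), referee ref-4.  WHAT IS REPRODUCED: SKELETON rows
**B1.Eq3.23** (`trunc2`, `trunc3`) and **B1.Eq3.24** (`Eq324`) — a KNITTING file (PHASE2-TARGETS §G.2(b)): the calculus
is `…Balaban1983to89.B10Eq24Cumulant` (whose header reads "← [Balaban1982Higgs1] (3.23)–(3.24) p. 616"; imported,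
not re-derived); what is added is the identification with the B1 carriers and the DISCHARGE of the typed display
`Eq324` from named leaves.  No new estimate is claimed; no `def … : Prop` is introduced.

THE PRINTED TEXT (verbatim, p. 616).  *"we use the cumulant expansion formula of the form
⟨exp(V)⟩ = exp[⟨V⟩ + (1/2!)⟨V²⟩^T + (1/3!)⟨V³⟩^T + …], (3.23) where ⟨·⟩ denotes the expectation value with respect to
the measure dμ_{C⁽⁰⁾}(A′)dμ_{C⁽⁰⁾(B⁽¹⁾)}(φ′), V = V⁽⁰⁾ and ⟨Vⁿ⟩^T denotes the truncated expectation of a product of n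
polynomials V, thus ⟨V²⟩^T = ⟨V²⟩ − ⟨V⟩², ⟨V³⟩^T = ⟨V³⟩ − 3⟨V²⟩⟨V⟩ + ⟨V⟩³* [sic] *, and so on. On the right side of
(3.23) there is a formal series, so obviously we can use only some truncated form of this expansion. … we would like
to have a cumulant expansion formula in the form taking into account the existence of the characteristic functions
also ⟨χ exp(V)⟩ = exp[⟨V⟩ + (1/2!)⟨V²⟩^T + … + (1/n̄!)⟨V^{n̄}⟩^T + O(ε^κ)|T₁|], κ > d. (3.24) There is one obvious way
of proving this formula, namely by a cluster expansion, but it is a long and tedious way. Instead we will rely on the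
results of Benfatto et al. [2]. The lemma formulated on p. 152 of this paper can be applied in our situation because
all the assumptions are satisfied."*

WHAT IS TYPED AND PROVED.
§1 (3.23) knitted: `trunc2_nmoment`, `trunc3_nmoment` — r12's `trunc2`/`trunc3` of the normalised moments ARE the
   truncated expectations `truncExp V ν 2`, `truncExp V ν 3` (the Taylor coefficients of `log ∫e^{tV}dν`);
   `printed_third_eq` — the printed third formula is `truncExp V ν 3 − ⟨V⟩³` (the recorded misprint, both files agree).
§2 `Eq324` unpacked: `eq324_iff_abs_log_sub_le` — for `lhs > 0`, `Eq324 lhs cum n̄ C s κ vol` is EXACTLY the two-sided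
   bound `|log lhs − Σ_{n=1}^{n̄} cum n/n!| ≤ C s^κ vol` (so the two "halves" of `B10Eq24Cumulant` §4 are its content);
   `Eq324.pos`.
§3 **(3.24) DISCHARGED FROM NAMED LEAVES**: `eq324_of_truncated_bound` — for a finite non-zero measure `ν` (= χ·Gaussian)
   and `V` bounded `ν`-a.e.: (a) `|log ν(Ω)| ≤ C₁ s^κ vol` (volume of the characteristic functions), (b) the cumulants
   `cum` written on the right of (3.24) (print: those of the UNWEIGHTED Gaussian `⟨·⟩`) differ from the `truncExp` of `ν`
   by `≤ C₂ s^κ vol` in the weighted sum, (c) `sup_{t∈[0,1]} |f⁽ⁿ̄⁺¹⁾(t)| ≤ C₃ (n̄+1)! s^κ vol`, `f = cgf V ν` — by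
   `B10Eq24Cumulant.truncExp_tilted` the truncated expectation of order `n̄+1` in the INTERPOLATED measure, i.e. the
   content of "the lemma on p. 152 of [2]" (`eq324_of_tilted_bound` states it in that form) — GIVE
   `Eq324 (∫ e^V dν) cum n̄ (C₁+C₂+C₃) s κ vol`; `eq324_self` (cum = own cumulants, `C₁+C₃`); and the verbatim
   `⟨χ exp V⟩` form `eq324_chi` for a probability measure `μ`, `0 ≤ χ ≤ 1` measurable with `⟨χ⟩ > 0`, `|V| ≤ B` on
   `{χ ≠ 0}` (`B10Eq24Cumulant.chiMeasure`).
§4 (v1.1) the k-th step version **(3.59)** p. 623: `cumulant359_iff` — `B1LowerBound.Cumulant359 fam` is DEFINITIONALLY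
   `∃ κ C, (∀ j, d_j < κ) ∧ ∀ j k, Eq324 (lhs k) (trunc k ·) n̄ C (L^kε) κ |T₁^{(k)}|`; `Realization` (dictionary: the data
   `μ, χ, V^{(k)}` per run and step with `lhs k = ⟨χe^{V}⟩`) and **`cumulant359_of_leaves`** — (3.59) from the same three
   leaves with constants UNIFORM in the run and the step.
NOT HERE: the leaves (a)–(c) themselves (cluster expansion / [2] / [14]).  No `sorry`, standard axioms only.
-/

open MeasureTheory ProbabilityTheory Filter Topology
open scoped BigOperators Nat

namespace Literature.MathematicalPhysics.QuantumFieldTheory.Balaban1983to89.B1Eq324CumulantTaylor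

open Literature.MathematicalPhysics.QuantumFieldTheory.Balaban1983to89.B10Eq24Cumulant

/-! ## §1  (3.23): the B1 carriers `trunc2` / `trunc3` are the truncated expectations -/

section Trunc

variable {Ω : Type*} {mΩ : MeasurableSpace Ω} {V : Ω → ℝ} {ν : Measure Ω} {B : ℝ}
variable [IsFiniteMeasure ν] [NeZero ν]

/-- **(3.23), order 2, knitted**: `trunc2 ⟨V⟩ ⟨V²⟩ = ⟨V²⟩ − ⟨V⟩² = ⟨V²⟩ᵀ`, the second Taylor coefficient (times `2!`)
of `t ↦ log ∫ e^{tV} dν` (`B10Eq24Cumulant.truncExp_two`). [cite: Balaban1982Higgs1, (3.23) p.616] -/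
theorem trunc2_nmoment (hV : AEMeasurable V ν) (hB : ∀ᵐ ω ∂ν, |V ω| ≤ B) :
    B1Sect3Statements.trunc2 (nmoment V ν 1) (nmoment V ν 2) = truncExp V ν 2 := by
  rw [truncExp_two hV hB, B1Sect3Statements.trunc2]

/-- **(3.23), order 3, knitted**: `trunc3 ⟨V⟩ ⟨V²⟩ ⟨V³⟩ = ⟨V³⟩ − 3⟨V²⟩⟨V⟩ + 2⟨V⟩³ = ⟨V³⟩ᵀ`
(`B10Eq24Cumulant.truncExp_three`). [cite: Balaban1982Higgs1, (3.23) p.616] -/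
theorem trunc3_nmoment (hV : AEMeasurable V ν) (hB : ∀ᵐ ω ∂ν, |V ω| ≤ B) :
    B1Sect3Statements.trunc3 (nmoment V ν 1) (nmoment V ν 2) (nmoment V ν 3) = truncExp V ν 3 := by
  rw [truncExp_three hV hB, B1Sect3Statements.trunc3]

/-- The PRINTED third formula «⟨V³⟩ − 3⟨V²⟩⟨V⟩ + ⟨V⟩³» equals `⟨V³⟩ᵀ − ⟨V⟩³` (misprint `+⟨V⟩³` for `+2⟨V⟩³`; recorded
as `B1Sect3Statements.trunc3_printed` and `B10Eq24Cumulant.printedThird_ne`). [cite: Balaban1982Higgs1, (3.23) p.616] -/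
theorem printed_third_eq (hV : AEMeasurable V ν) (hB : ∀ᵐ ω ∂ν, |V ω| ≤ B) :
    nmoment V ν 3 - 3 * nmoment V ν 2 * nmoment V ν 1 + nmoment V ν 1 ^ 3 = truncExp V ν 3 - nmoment V ν 1 ^ 3 := by
  rw [B1Sect3Statements.trunc3_printed, trunc3_nmoment hV hB]

end Trunc

/-! ## §2  `Eq324` unpacked: a two-sided bound on `log lhs` -/

/-- An `Eq324` left side is positive (it is an exponential). [cite: Balaban1982Higgs1, (3.24) p.616] -/
theorem _root_.Literature.MathematicalPhysics.QuantumFieldTheory.Balaban1983to89.B1Sect3Statements.Eq324.pos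
    {lhs : ℝ} {cum : ℕ → ℝ} {nbar : ℕ} {C s κ vol : ℝ} (h : B1Sect3Statements.Eq324 lhs cum nbar C s κ vol) :
    0 < lhs := by
  obtain ⟨r, -, hr⟩ := h
  rw [hr]
  exact Real.exp_pos _

/-- **`Eq324` IS the two-sided bound**: for `lhs > 0`,
`Eq324 lhs cum n̄ C s κ vol ↔ |log lhs − Σ_{n=1}^{n̄} cum n / n!| ≤ C s^κ vol`. [cite: Balaban1982Higgs1, (3.24) p.616] -/
theorem eq324_iff_abs_log_sub_le {lhs : ℝ} (hlhs : 0 < lhs) (cum : ℕ → ℝ) (nbar : ℕ) (C s κ vol : ℝ) :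
    B1Sect3Statements.Eq324 lhs cum nbar C s κ vol
      ↔ |Real.log lhs - ∑ n ∈ Finset.Icc 1 nbar, cum n / (n ! : ℝ)| ≤ C * s ^ κ * vol := by
  constructor
  · rintro ⟨r, hr, h⟩
    rwa [h, Real.log_exp, add_sub_cancel_left]
  · intro h
    exact ⟨Real.log lhs - ∑ n ∈ Finset.Icc 1 nbar, cum n / (n ! : ℝ), h, by rw [add_sub_cancel, Real.exp_log hlhs]⟩

/-! ## §3  (3.24) discharged from three named smallness inputs -/

/-- `Σ_{n=1}^{m} f n = Σ_{n<m} f (n+1)` (the Icc-indexed sum of `Eq324` versus the range-indexed one of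
`B10Eq24Cumulant.cgf_taylor_lagrange`); private plumbing. [folklore] -/
private theorem sum_Icc_eq_sum_range (f : ℕ → ℝ) (m : ℕ) :
    ∑ n ∈ Finset.Icc 1 m, f n = ∑ n ∈ Finset.range m, f (n + 1) := by
  induction m with
  | zero => simp
  | succ m ih => rw [Finset.sum_range_succ, ← ih, Finset.sum_Icc_succ_top (by omega)]

section Discharge

variable {Ω : Type*} {mΩ : MeasurableSpace Ω} {V : Ω → ℝ} {ν : Measure Ω} {B : ℝ}

/-- **(3.24) FROM THREE NAMED LEAVES.**  `ν` finite and non-zero (= χ·Gaussian), `|V| ≤ B` ν-a.e., `cum` the cumulants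
written on the right of (3.24), `s = ε`, `vol = |T₁|`.  If (a) `|log ν(Ω)| ≤ C₁ s^κ vol`, (b)
`|Σ_{n=1}^{n̄} (cum n − ⟨Vⁿ⟩ᵀ_ν)/n!| ≤ C₂ s^κ vol`, (c) `|f⁽ⁿ̄⁺¹⁾(t)| ≤ C₃ (n̄+1)! s^κ vol` on `[0,1]` (`f = log ∫e^{tV}dν`;
the truncated expectation of order `n̄+1` in the interpolated measure), then
`∫ e^V dν = exp[Σ_{n=1}^{n̄} cum n/n! + O(s^κ) vol]` with constant `C₁ + C₂ + C₃`. [cite: Balaban1982Higgs1, (3.24) p.616] -/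
theorem eq324_of_truncated_bound [IsFiniteMeasure ν] [NeZero ν] (hV : AEMeasurable V ν) (hB : ∀ᵐ ω ∂ν, |V ω| ≤ B)
    (nbar : ℕ) (cum : ℕ → ℝ) {C₁ C₂ C₃ s κ vol : ℝ}
    (ha : |Real.log (ν.real Set.univ)| ≤ C₁ * s ^ κ * vol)
    (hb : |∑ n ∈ Finset.Icc 1 nbar, (cum n - truncExp V ν n) / (n ! : ℝ)| ≤ C₂ * s ^ κ * vol)
    (hc : ∀ t ∈ Set.Icc (0 : ℝ) 1,
      |iteratedDeriv (nbar + 1) (cgf V ν) t| ≤ C₃ * ((nbar + 1)! : ℝ) * s ^ κ * vol) :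
    B1Sect3Statements.Eq324 (∫ ω, Real.exp (V ω) ∂ν) cum nbar (C₁ + C₂ + C₃) s κ vol := by
  obtain ⟨θ, hθ, hT⟩ := cgf_taylor_lagrange hV hB nbar
  have h1 := cgf_one_eq V ν
  have h0 := cgf_zero_eq V ν
  have hsum : ∑ n ∈ Finset.Icc 1 nbar, truncExp V ν n / (n ! : ℝ)
      = ∑ n ∈ Finset.range nbar, truncExp V ν (n + 1) / ((n + 1)! : ℝ) :=
    sum_Icc_eq_sum_range (fun n => truncExp V ν n / (n ! : ℝ)) nbar
  have hsplit : ∑ n ∈ Finset.Icc 1 nbar, (cum n - truncExp V ν n) / (n ! : ℝ)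
      = ∑ n ∈ Finset.Icc 1 nbar, cum n / (n ! : ℝ) - ∑ n ∈ Finset.Icc 1 nbar, truncExp V ν n / (n ! : ℝ) := by
    rw [← Finset.sum_sub_distrib]
    exact Finset.sum_congr rfl fun n _ => sub_div _ _ _
  have hpos : 0 < ∫ ω, Real.exp (V ω) ∂ν := by
    rw [← mgf_one_eq]
    exact mgf_pos_of_abs_le hV hB 1
  have hfac : (0 : ℝ) < ((nbar + 1)! : ℝ) := by positivity
  have hc' : |iteratedDeriv (nbar + 1) (cgf V ν) θ / ((nbar + 1)! : ℝ)| ≤ C₃ * s ^ κ * vol := by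
    rw [abs_div, abs_of_pos hfac, div_le_iff₀ hfac]
    calc |iteratedDeriv (nbar + 1) (cgf V ν) θ| ≤ C₃ * ((nbar + 1)! : ℝ) * s ^ κ * vol := hc θ ⟨hθ.1.le, hθ.2.le⟩
      _ = C₃ * s ^ κ * vol * ((nbar + 1)! : ℝ) := by ring
  refine ⟨Real.log (ν.real Set.univ) - ∑ n ∈ Finset.Icc 1 nbar, (cum n - truncExp V ν n) / (n ! : ℝ)
    + iteratedDeriv (nbar + 1) (cgf V ν) θ / ((nbar + 1)! : ℝ), ?_, ?_⟩
  · have h4 := abs_add_le (Real.log (ν.real Set.univ)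
        - ∑ n ∈ Finset.Icc 1 nbar, (cum n - truncExp V ν n) / (n ! : ℝ))
      (iteratedDeriv (nbar + 1) (cgf V ν) θ / ((nbar + 1)! : ℝ))
    have h5 := abs_sub (Real.log (ν.real Set.univ))
      (∑ n ∈ Finset.Icc 1 nbar, (cum n - truncExp V ν n) / (n ! : ℝ))
    linarith
  · have hlog : Real.log (∫ ω, Real.exp (V ω) ∂ν) = ∑ n ∈ Finset.Icc 1 nbar, cum n / (n ! : ℝ)
        + (Real.log (ν.real Set.univ) - ∑ n ∈ Finset.Icc 1 nbar, (cum n - truncExp V ν n) / (n ! : ℝ)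
          + iteratedDeriv (nbar + 1) (cgf V ν) θ / ((nbar + 1)! : ℝ)) := by
      linarith
    rw [← hlog, Real.exp_log hpos]

/-- … with the cumulants on the right those of `ν` itself (no leaf (b)): constant `C₁ + C₃`.
[cite: Balaban1982Higgs1, (3.24) p.616] -/
theorem eq324_self [IsFiniteMeasure ν] [NeZero ν] (hV : AEMeasurable V ν) (hB : ∀ᵐ ω ∂ν, |V ω| ≤ B) (nbar : ℕ)
    {C₁ C₃ s κ vol : ℝ} (ha : |Real.log (ν.real Set.univ)| ≤ C₁ * s ^ κ * vol)
    (hc : ∀ t ∈ Set.Icc (0 : ℝ) 1,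
      |iteratedDeriv (nbar + 1) (cgf V ν) t| ≤ C₃ * ((nbar + 1)! : ℝ) * s ^ κ * vol) :
    B1Sect3Statements.Eq324 (∫ ω, Real.exp (V ω) ∂ν) (truncExp V ν) nbar (C₁ + C₃) s κ vol := by
  have h := eq324_of_truncated_bound hV hB nbar (truncExp V ν) (C₂ := 0) ha (by simp) hc
  rwa [add_zero] at h

/-- … with leaf (c) stated VERBATIM as a bound on the truncated expectation of order `n̄+1` of `V` in the
INTERPOLATED (tilted) measures `e^{tV}ν/Z(t)`, `t ∈ [0,1]` (`B10Eq24Cumulant.truncExp_tilted`).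
[cite: Balaban1982Higgs1, (3.24) p.616] -/
theorem eq324_of_tilted_bound [IsFiniteMeasure ν] [NeZero ν] (hV : AEMeasurable V ν) (hB : ∀ᵐ ω ∂ν, |V ω| ≤ B)
    (nbar : ℕ) (cum : ℕ → ℝ) {C₁ C₂ C₃ s κ vol : ℝ}
    (ha : |Real.log (ν.real Set.univ)| ≤ C₁ * s ^ κ * vol)
    (hb : |∑ n ∈ Finset.Icc 1 nbar, (cum n - truncExp V ν n) / (n ! : ℝ)| ≤ C₂ * s ^ κ * vol)
    (hc : ∀ t ∈ Set.Icc (0 : ℝ) 1,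
      |truncExp V (ν.tilted fun ω => t * V ω) (nbar + 1)| ≤ C₃ * ((nbar + 1)! : ℝ) * s ^ κ * vol) :
    B1Sect3Statements.Eq324 (∫ ω, Real.exp (V ω) ∂ν) cum nbar (C₁ + C₂ + C₃) s κ vol :=
  eq324_of_truncated_bound hV hB nbar cum ha hb fun t ht => by
    rw [← truncExp_tilted hV hB t (Nat.succ_ne_zero nbar)]
    exact hc t ht

end Discharge

section Chi

variable {Ω : Type*} {mΩ : MeasurableSpace Ω} {μ : Measure Ω} {χ V : Ω → ℝ} {B : ℝ}

/-- **(3.24) VERBATIM, `⟨χ exp V⟩ = exp[Σ_{n=1}^{n̄} (1/n!) cum n + O(ε^κ)|T₁|]`**: `μ` a probability measure (the Gaussian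
`dμ_{C⁽⁰⁾}(A′)dμ(φ′)`), `χ` measurable with `0 ≤ χ ≤ 1` and `⟨χ⟩ > 0` (the small-field characteristic functions), `V`
μ-a.e.-measurable with `|V| ≤ B` on `{χ ≠ 0}`; leaves (a) `|log⟨χ⟩| ≤ C₁ s^κ vol`, (b) as above for the `χ`-weighted
law `B10Eq24Cumulant.chiMeasure μ χ`, (c) `|f_χ⁽ⁿ̄⁺¹⁾| ≤ C₃ (n̄+1)! s^κ vol` on `[0,1]`, `f_χ(t) = log⟨χ e^{tV}⟩`.  Then
`Eq324 ⟨χ e^V⟩ cum n̄ (C₁+C₂+C₃) s κ vol`. [cite: Balaban1982Higgs1, (3.24) p.616] -/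
theorem eq324_chi [IsProbabilityMeasure μ] (hχm : Measurable χ) (hχ0 : ∀ ω, 0 ≤ χ ω) (hχ1 : ∀ ω, χ ω ≤ 1)
    (hpos : 0 < ∫ ω, χ ω ∂μ) (hVm : AEMeasurable V μ) (hVB : ∀ ω, χ ω ≠ 0 → |V ω| ≤ B) (nbar : ℕ) (cum : ℕ → ℝ)
    {C₁ C₂ C₃ s κ vol : ℝ} (ha : |Real.log (∫ ω, χ ω ∂μ)| ≤ C₁ * s ^ κ * vol)
    (hb : |∑ n ∈ Finset.Icc 1 nbar, (cum n - truncExp V (chiMeasure μ χ) n) / (n ! : ℝ)| ≤ C₂ * s ^ κ * vol)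
    (hc : ∀ t ∈ Set.Icc (0 : ℝ) 1,
      |iteratedDeriv (nbar + 1) (cgf V (chiMeasure μ χ)) t| ≤ C₃ * ((nbar + 1)! : ℝ) * s ^ κ * vol) :
    B1Sect3Statements.Eq324 (∫ ω, χ ω * Real.exp (V ω) ∂μ) cum nbar (C₁ + C₂ + C₃) s κ vol := by
  haveI := isFiniteMeasure_chiMeasure (μ := μ) hχm hχ0 hχ1
  haveI := neZero_chiMeasure (μ := μ) hχm hχ0 hpos
  rw [← integral_chiMeasure hχm hχ0]
  rw [← chiMeasure_real_univ (μ := μ) hχm hχ0] at ha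
  exact eq324_of_truncated_bound (aemeasurable_chiMeasure hVm) (ae_chiMeasure_abs_le hχm hVB) nbar cum ha hb hc

/-- … and conversely the content of `Eq324 ⟨χe^V⟩ …` is the two-sided bound on `log⟨χ e^V⟩` (both halves of
`B10Eq24Cumulant` §4 at once). [cite: Balaban1982Higgs1, (3.24) p.616] -/
theorem abs_log_sub_le_of_eq324 {lhs : ℝ} {cum : ℕ → ℝ} {nbar : ℕ} {C s κ vol : ℝ}
    (h : B1Sect3Statements.Eq324 lhs cum nbar C s κ vol) :
    |Real.log lhs - ∑ n ∈ Finset.Icc 1 nbar, cum n / (n ! : ℝ)| ≤ C * s ^ κ * vol :=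
  (eq324_iff_abs_log_sub_le h.pos cum nbar C s κ vol).1 h

end Chi


/-! ## §4  The k-th step version (3.59) p. 623: `B1LowerBound.Cumulant359` is `Eq324` step by step, with ONE (κ, C) -/

section Step

open B1LowerBound (C359Setting Cumulant359)

/-- **(3.59) IS (3.24) AT EVERY STEP, UNIFORMLY**: `Cumulant359 fam` unfolds — definitionally — to
`∃ κ C, (∀ j, d_j < κ) ∧ ∀ j k, Eq324 (lhs k) (trunc k ·) n̄ C (L^kε) κ |T₁^{(k)}|`. [cite: Balaban1982Higgs1, (3.59) p.623] -/
theorem cumulant359_iff {J : Type} (fam : J → C359Setting) :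
    Cumulant359 fam ↔ ∃ κ C : ℝ, (∀ j, ((fam j).d : ℝ) < κ) ∧ ∀ (j : J) (k : ℕ),
      B1Sect3Statements.Eq324 ((fam j).lhs k) ((fam j).trunc k) (fam j).nbar C ((fam j).ell k) κ ((fam j).volK k) :=
  Iff.rfl

/-- MEASURE-THEORETIC REALIZATION of a (3.59) family (a dictionary, data only): at run `j` and step `k` a probability space
carrying the Gaussian measure `μ` (= `dμ_{C^{(k)}}(A′) dμ_{C^{(k)}(B^{(k+1)})}(φ′)` of (3.56)), the small-field characteristic
function `χ` (= `χ(A′)χ(φ′)`; measurable, `0 ≤ χ ≤ 1`, `⟨χ⟩ > 0`) and the polynomial `V = V^{(k)}`, μ-a.e.-measurable and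
bounded on `{χ ≠ 0}`, with `lhs k = ⟨χ e^{V}⟩`. [cite: Balaban1982Higgs1, (3.56), (3.59) pp.622–623] -/
structure Realization {J : Type} (fam : J → C359Setting) where
  /-- the configuration space at run `j`, step `k` -/
  Ω : J → ℕ → Type
  /-- its measurable structure -/
  mΩ : ∀ j k, MeasurableSpace (Ω j k)
  /-- the Gaussian (probability) measure of (3.56) -/
  μ : ∀ j k, Measure (Ω j k)
  prob : ∀ j k, IsProbabilityMeasure (μ j k)
  /-- the product of small-field characteristic functions -/
  χ : ∀ j k, Ω j k → ℝ
  /-- the effective polynomial `V^{(k)}` -/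
  V : ∀ j k, Ω j k → ℝ
  /-- a bound for `|V^{(k)}|` on the support of `χ` -/
  bd : J → ℕ → ℝ
  χ_meas : ∀ j k, Measurable (χ j k)
  χ_nonneg : ∀ j k ω, 0 ≤ χ j k ω
  χ_le_one : ∀ j k ω, χ j k ω ≤ 1
  χ_pos : ∀ j k, 0 < ∫ ω, χ j k ω ∂(μ j k)
  V_meas : ∀ j k, AEMeasurable (V j k) (μ j k)
  V_bd : ∀ j k ω, χ j k ω ≠ 0 → |V j k ω| ≤ bd j k
  lhs_eq : ∀ j k, (fam j).lhs k = ∫ ω, χ j k ω * Real.exp (V j k ω) ∂(μ j k)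

/-- **(3.59) DISCHARGED FROM THE THREE LEAVES WITH UNIFORM CONSTANTS**: given a realization, one `κ > d_j` (all `j`) and
constants `C₁, C₂, C₃` bounding, for every run and step, (a) `|log⟨χ⟩|`, (b) the weighted difference between the carrier's
truncated moments `trunc k n` and those of the `χ`-weighted law, (c) `sup_{[0,1]} |f_χ⁽ⁿ̄⁺¹⁾|/(n̄+1)!`, each by
`Cᵢ (L^kε)^κ |T₁^{(k)}|`, the typed (3.59) `Cumulant359 fam` holds with `C = C₁ + C₂ + C₃`. [cite: Balaban1982Higgs1, (3.59) p.623] -/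
theorem cumulant359_of_leaves {J : Type} {fam : J → C359Setting} (M : Realization fam) {κ C₁ C₂ C₃ : ℝ}
    (hκ : ∀ j, ((fam j).d : ℝ) < κ)
    (ha : ∀ j k, |Real.log (∫ ω, M.χ j k ω ∂(M.μ j k))| ≤ C₁ * (fam j).ell k ^ κ * (fam j).volK k)
    (hb : ∀ j k, |∑ n ∈ Finset.Icc 1 (fam j).nbar,
        ((fam j).trunc k n - truncExp (M.V j k) (chiMeasure (M.μ j k) (M.χ j k)) n) / (n ! : ℝ)|
      ≤ C₂ * (fam j).ell k ^ κ * (fam j).volK k)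
    (hc : ∀ j k, ∀ t ∈ Set.Icc (0 : ℝ) 1,
      |iteratedDeriv ((fam j).nbar + 1) (cgf (M.V j k) (chiMeasure (M.μ j k) (M.χ j k))) t|
        ≤ C₃ * (((fam j).nbar + 1)! : ℝ) * (fam j).ell k ^ κ * (fam j).volK k) :
    Cumulant359 fam := by
  refine (cumulant359_iff fam).2 ⟨κ, C₁ + C₂ + C₃, hκ, fun j k => ?_⟩
  letI := M.mΩ j k
  haveI := M.prob j k
  rw [M.lhs_eq j k]
  exact eq324_chi (M.χ_meas j k) (M.χ_nonneg j k) (M.χ_le_one j k) (M.χ_pos j k) (M.V_meas j k) (M.V_bd j k)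
    _ _ (ha j k) (hb j k) (hc j k)

end Step

end Literature.MathematicalPhysics.QuantumFieldTheory.Balaban1983to89.B1Eq324CumulantTaylor
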